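import Mathlib
import HarnessLib

/-!
# The Banach space of Lipschitz functions on `[0,1]`

Support file (all results proved) for the named fact
`Literature.NumberTheory.Sieve.MageeOhWinter2019_uniformCounting` (`CFSemigroupCounting.lean`).
The spectral theory of the transfer operators `L_s` of the continued fractions semigroup
([MageeOhWinter2019, Thm. 10, Thm. 4, §3.3]) takes place on a Banach space of regular functions on
`I = [0,1]` — `C¹(I)` in [MageeOhWinter2019, (2.3)], the Lipschitz space `L(K)` in Thm. 10 (after
Naud). This file constructs the complex Banach space `CfLip` of Lipschitz functions
`F : [0,1] → ℂ` with the norm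

  `‖F‖ = sup_{x} ‖F x‖ + Lip(F)`,   `Lip(F) = inf {C ≥ 0 : ‖F x - F y‖ ≤ C |x - y|}`

(`CfLip.norm_def`), and proves that it is a Banach space (`NormedAddCommGroup`, `NormedSpace ℂ`,
`CompleteSpace`), together with the basic estimates `‖F x‖ ≤ ‖F‖`, `‖F x - F y‖ ≤ ‖F‖ |x - y|`
(`CfLip.norm_apply_le`, `CfLip.norm_sub_apply_le`) and the constructor `CfLip.mk'` with its norm
bound (`CfLip.norm_mk'_le`). All of this is standard functional analysis ([folklore]); it is the
space denoted `L(K)`/`C¹(I)` in [MageeOhWinter2019, §2.2].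

## References

* M. Magee, H. Oh, D. Winter, J. reine angew. Math. 753 (2019) 89–135, §2.2, eq. (2.3).
  [MageeOhWinter2019]
-/

noncomputable section

open Set Filter
open scoped Topology

namespace Literature.NumberTheory.Sieve

/-- **Lipschitz functions on the unit interval** (the underlying type of the Banach space
`L([0,1])` of [MageeOhWinter2019, §2.2]). [cite: MageeOhWinter2019, §2.2] -/
structure CfLip where
  /-- the function -/
  toFun : Icc (0 : ℝ) 1 → ℂ
  /-- a Lipschitz bound -/
  lipschitz' : ∃ C : ℝ, ∀ x y : Icc (0 : ℝ) 1, ‖toFun x - toFun y‖ ≤ C * |(x : ℝ) - y|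

namespace CfLip

/-- Function-like structure: `CfLip` coerces to functions `[0,1] → ℂ`. [folklore] -/
instance instFunLike : FunLike CfLip (Icc (0 : ℝ) 1) ℂ where
  coe := CfLip.toFun
  coe_injective := by
    rintro ⟨f, _⟩ ⟨g, _⟩ h
    congr

/-- Extensionality. [folklore] -/
@[ext] theorem ext {F G : CfLip} (h : ∀ x, F x = G x) : F = G := DFunLike.ext _ _ h

/-- The field `toFun` is the coercion. [folklore] -/
@[simp] theorem toFun_eq_coe (F : CfLip) : F.toFun = ⇑F := rfl

/-- Every element has a nonnegative Lipschitz constant. [folklore] -/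
theorem exists_lipschitz (F : CfLip) :
    ∃ C : ℝ, 0 ≤ C ∧ ∀ x y : Icc (0 : ℝ) 1, ‖F x - F y‖ ≤ C * |(x : ℝ) - y| := by
  obtain ⟨C, hC⟩ := F.lipschitz'
  exact ⟨max C 0, le_max_right _ _, fun x y =>
    (hC x y).trans (mul_le_mul_of_nonneg_right (le_max_left _ _) (abs_nonneg _))⟩

/-! ### The linear structure -/

/-- **Constructor** from a function with a Lipschitz bound. [folklore] -/
def mk' (f : Icc (0 : ℝ) 1 → ℂ) (C : ℝ)
    (h : ∀ x y : Icc (0 : ℝ) 1, ‖f x - f y‖ ≤ C * |(x : ℝ) - y|) : CfLip := ⟨f, C, h⟩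

/-- Evaluation of the constructor. [folklore] -/
@[simp] theorem mk'_apply (f : Icc (0 : ℝ) 1 → ℂ) (C : ℝ)
    (h : ∀ x y : Icc (0 : ℝ) 1, ‖f x - f y‖ ≤ C * |(x : ℝ) - y|) (x : Icc (0 : ℝ) 1) :
    mk' f C h x = f x := rfl

/-- Pointwise multiplication by a scalar. [folklore] -/
def scale (c : ℂ) (F : CfLip) : CfLip :=
  mk' (fun x => c * F x) (‖c‖ * Classical.choose F.exists_lipschitz) fun x y => by
    have h := (Classical.choose_spec F.exists_lipschitz).2 x y
    rw [← mul_sub, norm_mul, mul_assoc]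
    exact mul_le_mul_of_nonneg_left h (norm_nonneg _)

/-- Evaluation of `scale`. [folklore] -/
@[simp] theorem scale_apply (c : ℂ) (F : CfLip) (x : Icc (0 : ℝ) 1) : scale c F x = c * F x := rfl

/-- Zero. [folklore] -/
instance : Zero CfLip := ⟨mk' 0 0 fun x y => by simp⟩
/-- Addition (pointwise). [folklore] -/
instance : Add CfLip := ⟨fun F G => mk' (fun x => F x + G x)
  (Classical.choose F.exists_lipschitz + Classical.choose G.exists_lipschitz) fun x y => by
    have hF := (Classical.choose_spec F.exists_lipschitz).2 x y
    have hG := (Classical.choose_spec G.exists_lipschitz).2 x y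
    calc ‖F x + G x - (F y + G y)‖ = ‖(F x - F y) + (G x - G y)‖ := by ring_nf
      _ ≤ ‖F x - F y‖ + ‖G x - G y‖ := norm_add_le _ _
      _ ≤ _ := by rw [add_mul]; exact add_le_add hF hG⟩
/-- Negation (pointwise). [folklore] -/
instance : Neg CfLip := ⟨fun F => scale (-1) F⟩
/-- Subtraction (pointwise). [folklore] -/
instance : Sub CfLip := ⟨fun F G => F + -G⟩
/-- Scalar multiplication by `ℂ`. [folklore] -/
instance : SMul ℂ CfLip := ⟨scale⟩
/-- Scalar multiplication by `ℕ`. [folklore] -/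
instance : SMul ℕ CfLip := ⟨fun n F => scale n F⟩
/-- Scalar multiplication by `ℤ`. [folklore] -/
instance : SMul ℤ CfLip := ⟨fun n F => scale n F⟩

/-- Coercion of zero. [folklore] -/
@[simp] theorem coe_zero : ⇑(0 : CfLip) = 0 := rfl
/-- Evaluation of zero. [folklore] -/
@[simp] theorem zero_apply (x : Icc (0 : ℝ) 1) : (0 : CfLip) x = 0 := rfl
/-- Evaluation of a sum. [folklore] -/
@[simp] theorem add_apply (F G : CfLip) (x : Icc (0 : ℝ) 1) : (F + G) x = F x + G x := rfl
/-- Evaluation of a negation. [folklore] -/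
@[simp] theorem neg_apply (F : CfLip) (x : Icc (0 : ℝ) 1) : (-F) x = -F x := by
  show (-1 : ℂ) * F x = -F x
  ring
/-- Evaluation of a difference. [folklore] -/
@[simp] theorem sub_apply (F G : CfLip) (x : Icc (0 : ℝ) 1) : (F - G) x = F x - G x := by
  show F x + (-1 : ℂ) * G x = F x - G x
  ring
/-- Evaluation of a scalar multiple. [folklore] -/
@[simp] theorem smul_apply (c : ℂ) (F : CfLip) (x : Icc (0 : ℝ) 1) : (c • F) x = c * F x := rfl
/-- Evaluation of an `ℕ`-multiple. [folklore] -/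
@[simp] theorem nsmul_apply (n : ℕ) (F : CfLip) (x : Icc (0 : ℝ) 1) : (n • F) x = (n : ℂ) * F x := rfl
/-- Evaluation of a `ℤ`-multiple. [folklore] -/
@[simp] theorem zsmul_apply (n : ℤ) (F : CfLip) (x : Icc (0 : ℝ) 1) : (n • F) x = (n : ℂ) * F x := rfl

/-- Additive group structure (pointwise). [folklore] -/
instance instAddCommGroup : AddCommGroup CfLip :=
  DFunLike.coe_injective.addCommGroup _ coe_zero (fun F G => funext fun x => add_apply F G x)
    (fun F => funext fun x => neg_apply F x) (fun F G => funext fun x => sub_apply F G x)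
    (fun n F => funext fun x => by rw [Pi.smul_apply, nsmul_apply, nsmul_eq_mul])
    (fun n F => funext fun x => by rw [Pi.smul_apply, zsmul_apply, zsmul_eq_mul])

/-- The coercion as an additive monoid homomorphism. [folklore] -/
def coeAddHom : CfLip →+ (Icc (0 : ℝ) 1 → ℂ) where
  toFun := DFunLike.coe
  map_zero' := coe_zero
  map_add' F G := funext fun x => add_apply F G x

/-- `ℂ`-module structure (pointwise). [folklore] -/
instance instModule : Module ℂ CfLip :=
  DFunLike.coe_injective.module ℂ coeAddHom fun c F => funext fun x => by
    rw [Pi.smul_apply, smul_eq_mul]; rfl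

/-! ### The Lipschitz seminorm and the sup norm -/

/-- The Lipschitz seminorm `Lip(F) = inf {C ≥ 0 : ‖F x - F y‖ ≤ C |x - y|}`. [folklore] -/
def lipNorm (F : CfLip) : ℝ :=
  sInf {C : ℝ | 0 ≤ C ∧ ∀ x y : Icc (0 : ℝ) 1, ‖F x - F y‖ ≤ C * |(x : ℝ) - y|}

/-- The sup norm `sup_x ‖F x‖`. [folklore] -/
def supNorm (F : CfLip) : ℝ := ⨆ x : Icc (0 : ℝ) 1, ‖F x‖

/-- The set of Lipschitz constants is nonempty. [folklore] -/
theorem lipSet_nonempty (F : CfLip) :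
    {C : ℝ | 0 ≤ C ∧ ∀ x y : Icc (0 : ℝ) 1, ‖F x - F y‖ ≤ C * |(x : ℝ) - y|}.Nonempty :=
  F.exists_lipschitz

/-- The set of Lipschitz constants is bounded below by `0`. [folklore] -/
theorem lipSet_bddBelow (F : CfLip) :
    BddBelow {C : ℝ | 0 ≤ C ∧ ∀ x y : Icc (0 : ℝ) 1, ‖F x - F y‖ ≤ C * |(x : ℝ) - y|} :=
  ⟨0, fun _ hC => hC.1⟩

/-- `Lip(F) ≥ 0`. [folklore] -/
theorem lipNorm_nonneg (F : CfLip) : 0 ≤ lipNorm F :=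
  le_csInf F.lipSet_nonempty fun _ hC => hC.1

/-- **The Lipschitz seminorm is a Lipschitz constant:** `‖F x - F y‖ ≤ Lip(F) |x - y|`. [folklore] -/
theorem lipNorm_spec (F : CfLip) (x y : Icc (0 : ℝ) 1) : ‖F x - F y‖ ≤ lipNorm F * |(x : ℝ) - y| := by
  rcases eq_or_ne ((x : ℝ)) y with hxy | hxy
  · have : x = y := Subtype.ext hxy
    simp [this]
  · have hpos : 0 < |(x : ℝ) - y| := abs_pos.2 (sub_ne_zero.2 hxy)
    rw [← div_le_iff₀ hpos]
    exact le_csInf F.lipSet_nonempty fun C hC => (div_le_iff₀ hpos).2 (hC.2 x y)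

/-- Minimality: any nonnegative Lipschitz constant bounds `Lip(F)`. [folklore] -/
theorem lipNorm_le {F : CfLip} {C : ℝ} (hC : 0 ≤ C)
    (h : ∀ x y : Icc (0 : ℝ) 1, ‖F x - F y‖ ≤ C * |(x : ℝ) - y|) : lipNorm F ≤ C :=
  csInf_le F.lipSet_bddBelow ⟨hC, h⟩

/-- `[0,1]` is nonempty. [folklore] -/
instance : Nonempty (Icc (0 : ℝ) 1) := ⟨⟨0, le_rfl, zero_le_one⟩⟩

/-- Lipschitz functions on `[0,1]` are bounded: `‖F x‖ ≤ ‖F 0‖ + Lip(F)`. [folklore] -/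
theorem norm_apply_le_aux (F : CfLip) (x : Icc (0 : ℝ) 1) :
    ‖F x‖ ≤ ‖F ⟨0, le_rfl, zero_le_one⟩‖ + lipNorm F := by
  have h := F.lipNorm_spec x ⟨0, le_rfl, zero_le_one⟩
  have hx : |(x : ℝ) - 0| ≤ 1 := by rw [sub_zero, abs_of_nonneg x.2.1]; exact x.2.2
  have h1 : ‖F x - F ⟨0, le_rfl, zero_le_one⟩‖ ≤ lipNorm F :=
    h.trans (mul_le_of_le_one_right F.lipNorm_nonneg hx)
  linarith [norm_le_norm_add_norm_sub' (F x) (F ⟨0, le_rfl, zero_le_one⟩)]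

/-- The range of `‖F ·‖` is bounded above. [folklore] -/
theorem supSet_bddAbove (F : CfLip) : BddAbove (Set.range fun x : Icc (0 : ℝ) 1 => ‖F x‖) :=
  ⟨‖F ⟨0, le_rfl, zero_le_one⟩‖ + lipNorm F, by rintro _ ⟨x, rfl⟩; exact F.norm_apply_le_aux x⟩

/-- `‖F x‖ ≤ sup`. [folklore] -/
theorem norm_apply_le_supNorm (F : CfLip) (x : Icc (0 : ℝ) 1) : ‖F x‖ ≤ supNorm F :=
  le_ciSup F.supSet_bddAbove x

/-- Minimality of the sup. [folklore] -/
theorem supNorm_le {F : CfLip} {M : ℝ} (h : ∀ x, ‖F x‖ ≤ M) : supNorm F ≤ M := ciSup_le h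

/-- `sup ≥ 0`. [folklore] -/
theorem supNorm_nonneg (F : CfLip) : 0 ≤ supNorm F :=
  (norm_nonneg _).trans (F.norm_apply_le_supNorm ⟨0, le_rfl, zero_le_one⟩)

/-! ### The norm -/

/-- `sup 0 = 0`. [folklore] -/
theorem supNorm_zero : supNorm (0 : CfLip) = 0 :=
  le_antisymm (supNorm_le fun x => by simp) (supNorm_nonneg 0)

/-- `Lip(0) = 0`. [folklore] -/
theorem lipNorm_zero : lipNorm (0 : CfLip) = 0 :=
  le_antisymm (lipNorm_le le_rfl fun x y => by simp) (lipNorm_nonneg 0)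

/-- Subadditivity of the sup norm. [folklore] -/
theorem supNorm_add_le (F G : CfLip) : supNorm (F + G) ≤ supNorm F + supNorm G :=
  supNorm_le fun x => by
    rw [add_apply]
    exact (norm_add_le _ _).trans (add_le_add (F.norm_apply_le_supNorm x) (G.norm_apply_le_supNorm x))

/-- Subadditivity of the Lipschitz seminorm. [folklore] -/
theorem lipNorm_add_le (F G : CfLip) : lipNorm (F + G) ≤ lipNorm F + lipNorm G :=
  lipNorm_le (add_nonneg F.lipNorm_nonneg G.lipNorm_nonneg) fun x y => by
    rw [add_apply, add_apply, add_mul]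
    calc ‖F x + G x - (F y + G y)‖ = ‖(F x - F y) + (G x - G y)‖ := by ring_nf
      _ ≤ ‖F x - F y‖ + ‖G x - G y‖ := norm_add_le _ _
      _ ≤ lipNorm F * |(x : ℝ) - y| + lipNorm G * |(x : ℝ) - y| :=
          add_le_add (F.lipNorm_spec x y) (G.lipNorm_spec x y)

/-- Homogeneity bound for the sup norm. [folklore] -/
theorem supNorm_smul_le (c : ℂ) (F : CfLip) : supNorm (c • F) ≤ ‖c‖ * supNorm F :=
  supNorm_le fun x => by
    rw [smul_apply, norm_mul]
    exact mul_le_mul_of_nonneg_left (F.norm_apply_le_supNorm x) (norm_nonneg _)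

/-- Homogeneity bound for the Lipschitz seminorm. [folklore] -/
theorem lipNorm_smul_le (c : ℂ) (F : CfLip) : lipNorm (c • F) ≤ ‖c‖ * lipNorm F :=
  lipNorm_le (mul_nonneg (norm_nonneg _) F.lipNorm_nonneg) fun x y => by
    rw [smul_apply, smul_apply, ← mul_sub, norm_mul, mul_assoc]
    exact mul_le_mul_of_nonneg_left (F.lipNorm_spec x y) (norm_nonneg _)

/-- Negation is multiplication by `-1`. [folklore] -/
theorem neg_eq_smul (F : CfLip) : -F = (-1 : ℂ) • F := rfl

/-- The sup norm is invariant under negation. [folklore] -/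
theorem supNorm_neg (F : CfLip) : supNorm (-F) = supNorm F := by
  unfold supNorm
  congr 1
  funext x
  rw [neg_apply, norm_neg]

/-- The Lipschitz seminorm is invariant under negation. [folklore] -/
theorem lipNorm_neg (F : CfLip) : lipNorm (-F) = lipNorm F := by
  refine le_antisymm ?_ ?_
  · exact lipNorm_le F.lipNorm_nonneg fun x y => by
      have e : (-F) x - (-F) y = -(F x - F y) := by rw [neg_apply, neg_apply]; ring
      rw [e, norm_neg]
      exact F.lipNorm_spec x y
  · exact lipNorm_le (-F).lipNorm_nonneg fun x y => by
      have h := (-F).lipNorm_spec x y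
      have e : F x - F y = -((-F) x - (-F) y) := by rw [neg_apply, neg_apply]; ring
      rw [e, norm_neg]
      exact h

/-- The norm `‖F‖ = sup ‖F‖ + Lip(F)` as an `AddGroupNorm`. [folklore] -/
def addGroupNorm : AddGroupNorm CfLip where
  toFun F := supNorm F + lipNorm F
  map_zero' := by simp only [supNorm_zero, lipNorm_zero, add_zero]
  add_le' F G := by
    have h1 := supNorm_add_le F G
    have h2 := lipNorm_add_le F G
    linarith
  neg' F := by simp only [supNorm_neg, lipNorm_neg]
  eq_zero_of_map_eq_zero' F h := by
    have h1 : supNorm F = 0 := by linarith [F.supNorm_nonneg, F.lipNorm_nonneg]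
    ext x
    have h2 := F.norm_apply_le_supNorm x
    rw [h1] at h2
    simpa using (norm_le_zero_iff.1 h2)

/-- **`CfLip` is a normed group** with `‖F‖ = sup + Lip`. [folklore] -/
instance instNormedAddCommGroup : NormedAddCommGroup CfLip :=
  AddGroupNorm.toNormedAddCommGroup addGroupNorm

/-- **The norm of `CfLip`:** `‖F‖ = sup_x ‖F x‖ + Lip(F)`. [cite: MageeOhWinter2019, eq. (2.3)] -/
theorem norm_def (F : CfLip) : ‖F‖ = supNorm F + lipNorm F := rfl

/-- `‖F x‖ ≤ ‖F‖`. [folklore] -/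
theorem norm_apply_le (F : CfLip) (x : Icc (0 : ℝ) 1) : ‖F x‖ ≤ ‖F‖ := by
  rw [norm_def]
  linarith [F.norm_apply_le_supNorm x, F.lipNorm_nonneg]

/-- `Lip(F) ≤ ‖F‖`. [folklore] -/
theorem lipNorm_le_norm (F : CfLip) : lipNorm F ≤ ‖F‖ := by
  rw [norm_def]; linarith [F.supNorm_nonneg]

/-- `sup ≤ ‖F‖`. [folklore] -/
theorem supNorm_le_norm (F : CfLip) : supNorm F ≤ ‖F‖ := by
  rw [norm_def]; linarith [F.lipNorm_nonneg]

/-- `‖F x - F y‖ ≤ ‖F‖ |x - y|`. [folklore] -/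
theorem norm_sub_apply_le (F : CfLip) (x y : Icc (0 : ℝ) 1) : ‖F x - F y‖ ≤ ‖F‖ * |(x : ℝ) - y| :=
  (F.lipNorm_spec x y).trans (mul_le_mul_of_nonneg_right F.lipNorm_le_norm (abs_nonneg _))

/-- The norm is controlled by a sup bound and a Lipschitz bound. [folklore] -/
theorem norm_le_of_bounds {F : CfLip} {M C : ℝ} (hC : 0 ≤ C) (hM : ∀ x, ‖F x‖ ≤ M)
    (hL : ∀ x y : Icc (0 : ℝ) 1, ‖F x - F y‖ ≤ C * |(x : ℝ) - y|) : ‖F‖ ≤ M + C := by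
  rw [norm_def]
  exact add_le_add (supNorm_le hM) (lipNorm_le hC hL)

/-- **Norm bound for the constructor.** [folklore] -/
theorem norm_mk'_le {f : Icc (0 : ℝ) 1 → ℂ} {C M : ℝ} (hC : 0 ≤ C)
    (h : ∀ x y : Icc (0 : ℝ) 1, ‖f x - f y‖ ≤ C * |(x : ℝ) - y|) (hM : ∀ x, ‖f x‖ ≤ M) :
    ‖mk' f C h‖ ≤ M + C :=
  norm_le_of_bounds hC hM h

/-- **`CfLip` is a complex normed space.** [folklore] -/
instance instNormedSpace : NormedSpace ℂ CfLip where
  norm_smul_le c F := by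
    rw [norm_def, norm_def, mul_add]
    exact add_le_add (supNorm_smul_le c F) (lipNorm_smul_le c F)

/-- Elements of `CfLip` are continuous. [folklore] -/
theorem continuous (F : CfLip) : Continuous F := by
  have hL : LipschitzWith ‖F‖.toNNReal F := by
    refine LipschitzWith.of_dist_le_mul fun x y => ?_
    rw [dist_eq_norm, Real.coe_toNNReal _ (norm_nonneg F), Subtype.dist_eq, Real.dist_eq]
    exact F.norm_sub_apply_le x y
  exact hL.continuous

/-! ### Completeness -/

/-- Evaluation is `1`-Lipschitz: `‖F x - G x‖ ≤ ‖F - G‖`. [folklore] -/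
theorem norm_apply_sub_apply_le (F G : CfLip) (x : Icc (0 : ℝ) 1) : ‖F x - G x‖ ≤ ‖F - G‖ := by
  rw [← sub_apply]; exact norm_apply_le _ x

/-- **`CfLip` is a Banach space.** [folklore] -/
instance instCompleteSpace : CompleteSpace CfLip := by
  apply Metric.complete_of_cauchySeq_tendsto
  intro u hu
  -- pointwise limits
  have hpt : ∀ x, CauchySeq fun n => u n x := by
    intro x
    rw [Metric.cauchySeq_iff] at hu ⊢
    intro ε hε
    obtain ⟨N, hN⟩ := hu ε hε
    refine ⟨N, fun m hm n hn => lt_of_le_of_lt ?_ (hN m hm n hn)⟩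
    rw [dist_eq_norm, dist_eq_norm]
    exact norm_apply_sub_apply_le _ _ x
  set f : Icc (0 : ℝ) 1 → ℂ := fun x => limUnder atTop fun n => u n x with hf
  have hfx : ∀ x, Tendsto (fun n => u n x) atTop (𝓝 (f x)) := fun x => (hpt x).tendsto_limUnder
  -- a uniform bound for the norms
  obtain ⟨R, -, hR⟩ := cauchySeq_bdd hu
  have hbound : ∀ n, ‖u n‖ ≤ ‖u 0‖ + R := fun n => by
    have h1 : dist (u n) (u 0) < R := hR n 0
    rw [dist_eq_norm] at h1
    linarith [norm_le_norm_add_norm_sub' (u n) (u 0)]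
  -- the limit is Lipschitz
  have hflip : ∀ x y : Icc (0 : ℝ) 1, ‖f x - f y‖ ≤ (‖u 0‖ + R) * |(x : ℝ) - y| := by
    intro x y
    have hlim : Tendsto (fun n => ‖u n x - u n y‖) atTop (𝓝 ‖f x - f y‖) :=
      ((hfx x).sub (hfx y)).norm
    exact le_of_tendsto' hlim fun n =>
      ((u n).norm_sub_apply_le x y).trans (mul_le_mul_of_nonneg_right (hbound n) (abs_nonneg _))
  set G : CfLip := mk' f _ hflip
  refine ⟨G, ?_⟩
  rw [Metric.tendsto_atTop]
  intro ε hε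
  rw [Metric.cauchySeq_iff] at hu
  obtain ⟨N, hN⟩ := hu (ε / 3) (by positivity)
  refine ⟨N, fun n hn => ?_⟩
  -- sup part
  have hsup : ∀ x, ‖(u n - G) x‖ ≤ ε / 3 := by
    intro x
    rw [sub_apply]
    have hlim : Tendsto (fun m => ‖u n x - u m x‖) atTop (𝓝 ‖u n x - G x‖) :=
      (tendsto_const_nhds.sub (hfx x)).norm
    refine le_of_tendsto hlim (eventually_atTop.2 ⟨N, fun m hm => ?_⟩)
    have h1 := hN n hn m hm
    rw [dist_eq_norm] at h1
    exact ((norm_apply_sub_apply_le _ _ x).trans h1.le)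
  -- Lipschitz part
  have hlip : ∀ x y : Icc (0 : ℝ) 1, ‖(u n - G) x - (u n - G) y‖ ≤ ε / 3 * |(x : ℝ) - y| := by
    intro x y
    rw [sub_apply, sub_apply]
    have hlim : Tendsto (fun m => ‖(u n x - u m x) - (u n y - u m y)‖) atTop
        (𝓝 ‖(u n x - G x) - (u n y - G y)‖) :=
      ((tendsto_const_nhds.sub (hfx x)).sub (tendsto_const_nhds.sub (hfx y))).norm
    refine le_of_tendsto hlim (eventually_atTop.2 ⟨N, fun m hm => ?_⟩)
    have h1 := hN n hn m hm
    rw [dist_eq_norm] at h1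
    have h2 := (u n - u m).norm_sub_apply_le x y
    rw [sub_apply, sub_apply] at h2
    exact h2.trans (mul_le_mul_of_nonneg_right h1.le (abs_nonneg _))
  rw [dist_eq_norm]
  calc ‖u n - G‖ ≤ ε / 3 + ε / 3 := norm_le_of_bounds (by positivity) hsup hlip
    _ < ε := by linarith

/-! ### Constants and evaluation -/

/-- The constant function. [folklore] -/
def const (c : ℂ) : CfLip := mk' (fun _ => c) 0 fun x y => by simp

/-- Evaluation of a constant. [folklore] -/
@[simp] theorem const_apply (c : ℂ) (x : Icc (0 : ℝ) 1) : const c x = c := rfl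

/-- `‖const c‖ ≤ ‖c‖` (in fact equality). [folklore] -/
theorem norm_const_le (c : ℂ) : ‖const c‖ ≤ ‖c‖ := by
  have h := norm_mk'_le (f := fun _ : Icc (0 : ℝ) 1 => c) (C := 0) (M := ‖c‖) le_rfl
    (fun x y => by simp) (fun _ => le_rfl)
  rw [add_zero] at h
  exact h

/-- Evaluation at a point is a bounded linear functional. [folklore] -/
def eval (x : Icc (0 : ℝ) 1) : CfLip →L[ℂ] ℂ :=
  LinearMap.mkContinuous
    { toFun := fun F => F x
      map_add' := fun F G => add_apply F G x
      map_smul' := fun c F => smul_apply c F x } 1 fun F => by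
    rw [one_mul]; exact F.norm_apply_le x

/-- Evaluation of the evaluation functional. [folklore] -/
@[simp] theorem eval_apply (x : Icc (0 : ℝ) 1) (F : CfLip) : eval x F = F x := rfl

end CfLip

end Literature.NumberTheory.Sieve
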